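import Literature.NumberTheory.EllipticCurves.Selmer
import Literature.NumberTheory.EllipticCurves.QuadraticTwist
import Literature.NumberTheory.EllipticCurves.GlobalMinimalModel
import Literature.NumberTheory.EllipticCurves.GaloisAction
import Literature.NumberTheory.EllipticCurves.Tamagawa
import Literature.NumberTheory.DiophantineGeometry.Conductor
import Literature.NumberTheory.EllipticCurves.BSDSelmerParityDokchitserBaseChangeProofs
import HarnessLib

/-!
# Toric periods of level-raised quaternionic eigenforms bound the `p^∞`-Selmer corank (C.-H. Kim 2024)

Named fact (D-0014) vendoring the consequence of the **structure theorem for Selmer groups via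
bipartite Euler systems** of C.-H. Kim, *A higher Gross–Zagier formula and the structure of Selmer
groups*, Trans. Amer. Math. Soc. 377 (2024) = arXiv:2203.12161 [Kim2024], that route
`BirchSwinnertonDyer/ToricShedding` consumes as its literature-leaf crux
`Summit.BirchSwinnertonDyer.BirchSwinnertonDyer.Theses.ToricShedding.BipartiteToricBound`
(item `stmt-BirchSwinnertonDyer-16085`), together with the bridge to that item.

## The printed statements (locators from the HELD arXiv text = v3, read 2026-08-16; published
numbering in brackets)

TEXT VERSIONS (ARM P D-audit, reader bsd-cited-r10 sheet `D-AUDIT-r10-S2.md` sha16 e834568ff3dcc1ae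
§B B15′ / §D F6–F7; typer bsd-cited-ty4, DOC-DEBT DD-26 (a), 2026-08-27; statements below untouched).
The held text `paper:arxiv-2203.12161` is arXiv **v3** (pre-referee). The published text (TAMS 377
(2024), no. 5; proxy = arXiv **v7** "to appear", e-print TeX source sha16 945b976f03ff399f under
`pub/bsd-cited/staging/bsd-cited-ty4/TYQ21/kim24v7/`, PDF f16b4dc77808bbde) renumbers §5 → §4:
Assumption 5.20 → **4.21**, Thm 5.21 → **4.22**, §5.2.3 → **§4.2.3**, Thm 5.18 → **4.19**, Thm 5.23 →
**4.24**, App. §8 → **App. A**, and CHANGES two audited items — full concordance with verbatim quotes in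
the sibling `Kim2024/DefiniteSelmerStructure.lean` (§ "Text versions and published numbering"):
(α) v7 Thm 4.24 ASSUMES the mod-`p^k` bipartite Euler systems free for every `k` (Def 4.16) [v7 TeX
L1121–L1125]; the UNCONDITIONAL printed statement is the mod-`p^k` **Thm 4.26** (with Lemma 4.25 =
[Howard2006, Lemma 3.3.6]) at levels `n ∈ 𝒩^def_j`, **`j ≥ 2k`** [L1166–L1188] — and THAT is what the
fact below uses: it asks `2M`-admissible levels for a mod-`p^M` period, i.e. `k = M`, `j = 2M`
(reader's verdict B15′: «VERBATIM (weaker) w.r.t. v7 Thm 4.26», flag-free; derivation: Thm 4.19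
[L1004–L1013] gives `∂^(2s)(λ^{bip,(M),2M}) = min{M, δ + Σ_{i ≥ s+1} d_i}` for
`Sel(K, E[p^M]) ≃ ⨁_i (ℤ/p^{d_i})^{⊕2}`, so `λ^{bip,(M)}_n ≠ 0` at `ν(n) = 2s` forces `d_i < M` for
`i > s`, whence at most `2s` summands `ℤ/p^M` and — `Sel(K, E[p^M]) = Sel(K, E[p^∞])[p^M]` as
`E(K)[p] = 0` under (a), displayed in print [L1131–L1135] — `corank ≤ 2s = ν(n)`);
(β) v7 §2.1 reads "`(D_K, Np) = 1`, **`D_K` is odd and `≠ −3`**" [L244] and adds "Hypotheses (a) and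
(b) also hold for the quadratic twist `E^K`" [L256], whereas v3 had `D_K` odd only in its §2.7
recollection of the classical Gross–Zagier formula "for convenience" [v3 p0007 L7] (the sentence this
paragraph replaces said so). The fact below keeps v3's `K`-binders (`d_K < -4`, parity free): w.r.t.
v7 it is therefore formally STRONGER-THAN-PRINT on even-`d_K` fields (reader F6; 0 classes — its one
consumer, route item `ToricShedding.BipartiteToricBound`, takes `K` existentially); an `Odd (discr K)`
binder (in place or as a one-binder twin) is the route owner's call (lead ruling (79)), not made here;
(a) for `E^K` follows from (a) for `E` at `p ≥ 5`, (b) for `E^K` as (b) below.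

* §2.1 *Working hypotheses* [v3 p0005 L3–L27; v7 TeX L237–L256]: `E/ℚ` non-CM of conductor `N`,
  `p ≥ 5` with (a) `ρ̄_{E,p}` surjective, (b) Manin constant prime to `p`; `K` imaginary quadratic
  with `(D_K, Np) = 1` (v7: "`D_K` is odd and `≠ −3`", see (β)), `N = N⁺N⁻` (primes of `N⁺` split,
  of `N⁻` inert), (c) `N⁻` square-free, (d) `ν(N⁻)` odd ⇒ good reduction at `p`, (e) (Condition CR)
  `ν(N⁻)` odd, `q ∣ N⁻`, `q ≡ ±1 (mod p)` ⇒ `ρ̄` ramified at `q`. (The Gross point of conductor `1`,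
  v3 §8 = v7 App. A, is built for both parities of `D_K` [v7 TeX L1790–L1792].)
* §2.4: `𝒫^adm_k = {q prime : q ∤ Np, q inert in K, p ∤ q² - 1, a_q(E) ≡ ε_q (q+1) (mod p^k), ε_q = ±1}`,
  `I^adm_q = (a_q(E) - ε_q(q+1))ℤ_p`, `𝒩^adm_k` = square-free products, `I^adm_n = Σ_{ℓ∣n} I^adm_ℓ`,
  `𝒩^def_k ⊆ 𝒩^adm_k`: `ν(nN⁻)` odd; `ord(λ^bip) = min{ν(n) : n ∈ 𝒩^def_1, λ^bip_n ≠ 0}`.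
* Assumption 5.20 [v7: 4.21, TeX L1027–L1033]: `E[p]` absolutely irreducible as a `G_ℚ`-module,
  good reduction at `p`, CR. §5.2.1 [v7 §4.2.1, L1022] moreover assumes `E[p]` absolutely
  irreducible as a `G_K`-module.
* §5.2.2 / Thm 5.21 [v7: 4.22, L1048–L1070] (weak level raising, after [BertoliniDarmon2005], [PollackWeston2011],
  [ChidaHsieh2014]): `B_{nN⁻}` the definite quaternion algebra of discriminant `nN⁻`, `R_{N⁺}` an
  Eichler order of level `N⁺`; for `n ∈ 𝒩^def` there is a mod-`I^adm_n` quaternionic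
  `𝕋^{nN⁻}(N⁺)`-eigenform `f_{nN⁻} : B×_{nN⁻} \ B̂×_{nN⁻} / R̂×_{N⁺} → ℤ_p/I^adm_n ℤ_p` with
  `T_q ↦ a_q(f)` (`q ∤ nN`), non-zero mod `p`.
* §5.2.3 [v7 §4.2.3, L1071–L1077]: `λ^bip_n = Σ_{σ ∈ Gal(H/K)} f_{nN⁻}(σ · ς^(0)) ∈ ℤ_p/I^adm_n ℤ_p`,
  the **toric period** over `Gal(H/K) ≅ K× \ K̂× / 𝒪̂_K×` (acting by left translation through an
  embedding `K ↪ B`) of the Gross point `ς^(0)` of conductor `1` (§8 [v7 App. A]).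
* **Theorem 5.23** [v7: Thm **4.24**, L1121–L1125, which ADDS the hypothesis "(λ^{bip,(k)}, κ^{bip,(k)})
  is free for every `k ≥ 1`" — see (α) above]. "Suppose that `λ^bip ≠ 0`. Then we have isomorphism
  `Sel(K, E[p^∞]) ≃ (ℚ_p/ℤ_p)^{⊕ ord(λ^bip)} ⊕ ⨁_{i ≥ 1} (ℤ/p^{∂^{(ord+2(i-1))}(λ^bip) - ∂^{(ord+2i)}(λ^bip)} ℤ)^{⊕2}`."
  In particular `corank_{ℤ_p} Sel(K, E[p^∞]) = ord(λ^bip) ≤ ν(n)` for every `n ∈ 𝒩^def_1` with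
  `λ^bip_n ≠ 0`; the form vendored here is the mod-`p^M` one at `2M`-admissible `n`, which is the
  unconditional v7 **Thm 4.26** (`k = M`, `j = 2M`) [L1175–L1188]. (Remark 2.1 [v7 TeX L331]: no
  ordinarity is needed; the proof runs Thm 5.18 [v7: 4.19] for the free bipartite Euler system
  `λ^{bip,(k)}` on `2k`-admissible `n`, after [Howard2006, §§2–3] — v7 Lemma 4.25.)

## Typing (identical, binder for binder, to the route items `ToricPeriodShedding` / `BipartiteToricBound`)

Everything is over Mathlib only (no `Literature.NumberTheory.Automorphic` import, whose Brandt
package `Brandt.IsGrossPoint` / `Brandt.toricPeriod` (`BrandtGrossPoints.lean`) names the same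
notions but sits in the adelic import cone the route must avoid): `B = QuaternionAlgebra ℚ a 0 b`
with `a, b < 0`, a division algebra at `q` iff `q ∣ N⁻n` (so `B = B_{nN⁻}`); `O = O₁ ⊓ O₂` an
Eichler order of level `N⁺` (`O₁, O₂` maximal `ℤ`-orders, `[O₁ : O] = N⁺`); `RI` = invertible right
`O`-ideals (full `ℤ`-lattices `J` with right order `O` and `J J' = O_L(J)`, `J' J = O`), i.e.
`B̂×/R̂×_{N⁺}`; a function `φ : RI → ℤ/p^M` invariant under `J ↦ βJ` (`β ∈ B×`) is a function on
`B× \ B̂× / R̂×`; the Hecke operator `T_q` (`q ∤ Nn`) is the sum over the `q+1` right-`O`-stable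
sublattices of index `q²` (the double coset `R̂× g_q R̂×` acts by `x ↦ x g_i`, i.e. on sub-ideals);
`IsEig g` = `B×`-invariance + `T_q g = a_q(E) g` for all `q ∤ Nn`; `φ` is primitive (a unit value)
and alone on its eigenline mod `p^M` (multiplicity one, a HYPOTHESIS); a Gross point of conductor
`1` is `(ψ, I)` with `I ∈ RI` and `ψ : K → B` embedding `𝒪_K` optimally into the left order of `I`;
its `Pic(𝒪_K)`-orbit is `[𝔞] ↦ ψ(𝔞) I` (integral representatives `rep`) and the toric period is
`Σ_{[𝔞]} φ(ψ(rep 𝔞) I)`; `n` is `2M`-admissible (`p^{2M} ∣ a_ℓ ∓ (ℓ+1)`), so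
`I^adm_n ⊆ p^{2M} ℤ_p` and "`≠ 0` in `ℤ/p^M`" implies "`≠ 0` in `ℤ_p/I^adm_n`".

How the side conditions give Kim's hypotheses: (a) is `HasSurjectiveModNGaloisRep p`, which for
`p ≥ 5` forces non-CM and absolute irreducibility of `E[p]` over `G_ℚ` and over `G_K` (the image
of `G_K` has index `≤ 2`, hence contains `SL₂(𝔽_p)`); (b) from good reduction at `p` and (a) (Mazur:
the Manin constant of the optimal curve is a `p`-unit for `p ∤ N`, and isogenies inside the class
have degree prime to `p` when `ρ̄` is surjective) — and (b) is not used in §5; (c), (d) are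
conjuncts; (e) and CR are vacuous because `p ∤ q² - 1` for every `q ∣ N`.

Two reading steps separate the fact from the letter of Thm 5.23 and are recorded here, not hidden:
(i) Kim's `f_{nN⁻}` is THE level-raised Jacquet–Langlands eigenform of Thm 5.21; the fact speaks of
any anemic mod-`p^M` eigenfunction `φ` with the eigenvalues `a_q(E)` that is primitive and alone on
its eigenline — under that multiplicity-one hypothesis `f_{nN⁻} mod p^M = u · φ` with `u` a unit, so
the two toric periods vanish together; (ii) Kim's `ς^(0)` is one specific conductor-`1` Gross point
(§8, after Chida–Hsieh); the fact quantifies over all conductor-`1` Gross points `(ψ, I)`.  These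
form a single orbit under `K̂× × W` (`W` the Atkin–Lehner normaliser elements at `q ∣ N⁺N⁻n`; local
optimal-embedding classes of `𝒪_{K,q}` number `≤ 2` and are swapped by the normaliser —
Eichler's embedding theory, [Gross1987, §3] for prime level, [Voight2021, §30.3–30.5]), the `K×`
and `Pic(𝒪_K)` parts are absorbed by `B×`-invariance and the orbit sum, and `φ ∘ w = ±φ` by
multiplicity one and primitivity, so non-vanishing of the toric period does not depend on the
Gross point.  A reviewer who wants the letter of §8 should read the fact as Thm 5.23 composed with
this transitivity.

## Contents

* `kim_selmerCorank_baseChange_le_of_toricPeriod_ne_zero` — the named fact (conclusion over `K`,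
  as printed: `corank_{ℤ_p} Sel_{p^∞}(E/K) ≤ ν(n)`).
* `selmerCorank_add_twist_le_of_toricPeriod_ne_zero` — the fact composed with the PROVED tree
  theorem `selmerCorank_baseChange_quadratic_holds` ([DokchitserDokchitserAnnals2010, Lem. 4.14]:
  `corank Sel_{p^∞}(E/K) = corank Sel_{p^∞}(E/ℚ) + corank Sel_{p^∞}(E^{d_K}/ℚ)`) is, verbatim, the
  route item `BipartiteToricBound`: item = fact ∘ DD2010.

## Not here

The bipartite Euler system formalism (Selmer structures over `ℤ/p^k`, Thm 5.18 [v7: 4.19]), level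
raising (Thm 5.21 [v7: 4.22]) and the reciprocity laws — the item stays a literature leaf of
difficulty XL; Gross's special value formula (`n = 1`); the non-triviality of `λ^bip` (Kim Cor. 7.16
[v7: Cor. 6.15], from the anticyclotomic main conjecture).
-/

namespace Literature.NumberTheory.EllipticCurves

open scoped BigOperators

/-- **Kim 2024, Thm 5.23 of the held arXiv v3 = published (TAMS 377 / arXiv v7) Thm 4.26 at
`k = M`, `j = 2M` (corank form): a non-zero toric period of a level-raised mod-`p^M` quaternionic
eigenform at `ν(n)` `2M`-admissible primes bounds `corank_{ℤ_p} Sel_{p^∞}(E/K) ≤ ν(n)`.**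
Data and side conditions exactly as in route item `ToricShedding.BipartiteToricBound` (see the
module docstring for the dictionary): `W` a global minimal model of `E/ℚ`; `p ≥ 5` good (ordinary —
not needed by the source, Remark 2.1, kept to match the item) with `ρ̄_{E,p}` surjective and
`p ∤ q² - 1` for `q ∣ N` (makes Condition CR vacuous); `K` imaginary quadratic, `d_K < -4`,
`(d_K, Np) = 1`; `N = N⁺N⁻`, `N⁺`-primes split, `N⁻ n`-primes inert, `N⁻` square-free with `ν(N⁻)`
odd; `n` square-free, prime to `N p d_K`, every `ℓ ∣ n` `2M`-admissible; `B = (a, b)_ℚ` definite,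
ramified exactly at the primes of `N⁻n`; `O` Eichler of level `N⁺`; `RI` the invertible right
`O`-ideals; `IsEig` = left-`B×`-invariance on `RI` + `T_q`-eigenvalue `a_q(E)` for `q ∤ Nn`; `φ` an
`IsEig` function, primitive, alone on its eigenline; `(ψ, I, rep)` a Gross point of conductor `1`
with ideal-class representatives.  Conclusion: if the toric period `Σ_{[𝔞] ∈ Cl_K} φ(ψ(rep 𝔞)·I)`
is `≠ 0` in `ℤ/p^M` then `corank_{ℤ_p} Sel_{p^∞}(E/K) ≤ ν(n)` (`WeierstrassCurve.selmerCorank` of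
the base change `W_K`).  Printed: "Suppose that `λ^bip ≠ 0`. Then
`Sel(K, E[p^∞]) ≃ (ℚ_p/ℤ_p)^{⊕ ord(λ^bip)} ⊕ ⨁_{i≥1}(ℤ/p^{∂^{(ord+2(i-1))}(λ^bip) - ∂^{(ord+2i)}(λ^bip)}ℤ)^{⊕2}`",
with `ord(λ^bip) = min{ν(n) : n ∈ 𝒩^def_1, λ^bip_n ≠ 0}` (§2.4) and
`λ^bip_n = Σ_{σ ∈ Gal(H/K)} f_{nN⁻}(σ·ς^(0))` (§5.2.3).  Published text (module docstring, "TEXT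
VERSIONS"): covered by the UNCONDITIONAL v7 Thm 4.26 with Lemma 4.25 (`k = M`, `j = 2M`; ARM P reader
r10 sheet e834568ff3dcc1ae B15′ «VERBATIM (weaker) w.r.t. v7 Thm 4.26»); v7 §2.1's "`D_K` odd" is NOT
among the binders (`d_K < -4` only — reader F6, formal, 0 classes; the route owner's call).  Grounds
`Summit.BirchSwinnertonDyer.BirchSwinnertonDyer.Theses.ToricShedding.BipartiteToricBound`.
[cite: Kim2024, Thm 5.23 with Thm 5.21, §5.2.3, §2.1, §2.4, Assumption 5.20, §8 (arXiv v3 numbering) = Thm 4.26 with Lemma 4.25, Thm 4.22, §4.2.3, §2.1, §2.4, Assumption 4.21, App. A (published numbering, arXiv:2203.12161v7 TeX L237–L256, L298–L331, L1027–L1077, L1166–L1188)] -/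
def kim_selmerCorank_baseChange_le_of_toricPeriod_ne_zero : Prop :=
    ∀ (W : WeierstrassCurve ℚ) [W.IsElliptic] [W.IsGloballyMinimal] (p : ℕ) [Fact p.Prime] (M Nplus
      Nminus n : ℕ) (a b : ℚ) (O : Subring (QuaternionAlgebra ℚ a 0 b)) (K : Type) [Field K]
      [NumberField K] (ψ : K →ₐ[ℚ] QuaternionAlgebra ℚ a 0 b) (I : Submodule ℤ (QuaternionAlgebra ℚ
      a 0 b)) (φ : Submodule ℤ (QuaternionAlgebra ℚ a 0 b) → ZMod (p ^ M)) (rep : ClassGroup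
      (NumberField.RingOfIntegers K) → nonZeroDivisors (Ideal (NumberField.RingOfIntegers K))) (RI :
      Set (Submodule ℤ (QuaternionAlgebra ℚ a 0 b))) (IsEig : (Submodule ℤ (QuaternionAlgebra ℚ a 0
      b) → ZMod (p ^ M)) → Prop), ((5 ≤ p ∧ 1 ≤ M ∧ W.HasGoodReductionAtPrime p ∧ ¬ (p : ℤ) ∣
      W.frobeniusTrace p ∧ W.HasSurjectiveModNGaloisRep p ∧ (∀ q : ℕ, q.Prime → q ∣ W.conductorNorm
      ℤ → ¬ (p : ℤ) ∣ (q : ℤ) ^ 2 - 1)) ∧ (Module.finrank ℚ K = 2 ∧ NumberField.IsTotallyComplex K ∧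
      NumberField.discr K < -4 ∧ Int.gcd (NumberField.discr K) (W.conductorNorm ℤ * p) = 1) ∧
      (W.conductorNorm ℤ = Nplus * Nminus ∧ Nat.Coprime Nplus Nminus ∧ Squarefree Nminus ∧ Odd
      Nminus.primeFactors.card ∧ (∀ q : ℕ, q.Prime → q ∣ Nplus → ((Ideal.span {(q : ℤ)}).primesOver
      (NumberField.RingOfIntegers K)).ncard = 2) ∧ (∀ q : ℕ, q.Prime → q ∣ Nminus * n → ((Ideal.span
      {(q : ℤ)}).primesOver (NumberField.RingOfIntegers K)).ncard = 1)) ∧ (Squarefree n ∧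
      Nat.Coprime n (W.conductorNorm ℤ * p) ∧ Int.gcd (NumberField.discr K) n = 1 ∧ (∀ ℓ : ℕ,
      ℓ.Prime → ℓ ∣ n → ¬ (p : ℤ) ∣ (ℓ : ℤ) ^ 2 - 1 ∧ ((p : ℤ) ^ (2 * M) ∣ W.frobeniusTrace ℓ - (ℓ +
      1) ∨ (p : ℤ) ^ (2 * M) ∣ W.frobeniusTrace ℓ + (ℓ + 1)))) ∧ (a < 0 ∧ b < 0 ∧ (∀ (q : ℕ) [Fact
      q.Prime], (∀ x : QuaternionAlgebra ℚ_[q] (a : ℚ_[q]) 0 (b : ℚ_[q]), x ≠ 0 → IsUnit x) ↔ q ∣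
      Nminus * n)) ∧ (∃ O₁ O₂ : Subring (QuaternionAlgebra ℚ a 0 b), (∀ S : Subring
      (QuaternionAlgebra ℚ a 0 b), (S = O₁ ∨ S = O₂) → (S.toAddSubgroup.FG ∧ (∀ d :
      QuaternionAlgebra ℚ a 0 b, ∃ m : ℤ, m ≠ 0 ∧ m • d ∈ S) ∧ ∀ S' : Subring (QuaternionAlgebra ℚ a
      0 b), S'.toAddSubgroup.FG → S ≤ S' → S' = S)) ∧ O = O₁ ⊓ O₂ ∧ O.toAddSubgroup.relIndex
      O₁.toAddSubgroup = Nplus) ∧ ((∀ J : Submodule ℤ (QuaternionAlgebra ℚ a 0 b), J ∈ RI ↔ (J.FG ∧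
      (∀ d : QuaternionAlgebra ℚ a 0 b, ∃ m : ℤ, m ≠ 0 ∧ m • d ∈ J) ∧ (∀ x : QuaternionAlgebra ℚ a 0
      b, (∀ y ∈ J, y * x ∈ J) ↔ x ∈ O) ∧ (∃ J' : Submodule ℤ (QuaternionAlgebra ℚ a 0 b), (∀ x :
      QuaternionAlgebra ℚ a 0 b, x ∈ J * J' ↔ ∀ y ∈ J, x * y ∈ J) ∧ (∀ x : QuaternionAlgebra ℚ a 0
      b, x ∈ J' * J ↔ x ∈ O)))) ∧ (∀ g : Submodule ℤ (QuaternionAlgebra ℚ a 0 b) → ZMod (p ^ M),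
      IsEig g ↔ ((∀ J ∈ RI, ∀ β : QuaternionAlgebra ℚ a 0 b, IsUnit β → g (J.map
      (AddMonoidHom.mulLeft β).toIntLinearMap) = g J) ∧ (∀ q : ℕ, q.Prime → ¬ q ∣ W.conductorNorm ℤ
      * n → ∀ J ∈ RI, ∑ᶠ J' ∈ {J' : Submodule ℤ (QuaternionAlgebra ℚ a 0 b) | J' ≤ J ∧
      J'.toAddSubgroup.relIndex J.toAddSubgroup = q ^ 2 ∧ ∀ y ∈ J', ∀ x ∈ O, y * x ∈ J'}, g J' =
      ((W.frobeniusTrace q : ℤ) : ZMod (p ^ M)) * g J))) ∧ IsEig φ ∧ (∃ J ∈ RI, IsUnit (φ J)) ∧ (∀ g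
      : Submodule ℤ (QuaternionAlgebra ℚ a 0 b) → ZMod (p ^ M), IsEig g → ∃ u : ZMod (p ^ M), ∀ J ∈
      RI, g J = u * φ J)) ∧ (I ∈ RI ∧ (∀ x : NumberField.RingOfIntegers K, ∀ y ∈ I, ψ (x : K) * y ∈
      I) ∧ (∀ x : K, (∀ y ∈ I, ψ x * y ∈ I) → ∃ z : NumberField.RingOfIntegers K, (z : K) = x) ∧ (∀
      𝔞 : ClassGroup (NumberField.RingOfIntegers K), ClassGroup.mk0 (rep 𝔞) = 𝔞))) → (∑ 𝔞 :
      ClassGroup (NumberField.RingOfIntegers K), φ (Submodule.span ℤ ((fun x :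
      NumberField.RingOfIntegers K => ψ (x : K)) '' ((rep 𝔞 : nonZeroDivisors (Ideal
      (NumberField.RingOfIntegers K))) : Ideal (NumberField.RingOfIntegers K))) * I)) ≠ 0 →
    (W.baseChange K).selmerCorank p ≤ n.primeFactors.card


/-- **The route item `ToricShedding.BipartiteToricBound` is the fact composed with
Dokchitser–Dokchitser's Lemma 4.14.**  From
`kim_selmerCorank_baseChange_le_of_toricPeriod_ne_zero` (`corank Sel_{p^∞}(E/K) ≤ ν(n)`) and the
proved tree theorem `selmerCorank_baseChange_quadratic_holds`
(`corank Sel_{p^∞}(E/K) = corank Sel_{p^∞}(E/ℚ) + corank Sel_{p^∞}(E^{d_K}/ℚ)` for `[K : ℚ] = 2`):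
`corank_{ℤ_p} Sel_{p^∞}(E/ℚ) + corank_{ℤ_p} Sel_{p^∞}(E^{d_K}/ℚ) ≤ ν(n)`.  The statement below is the
item's signature verbatim. [cite: Kim2024, Thm 5.23 (arXiv v3) = Thm 4.26 (published, arXiv v7 TeX L1175–L1188)] -/
theorem selmerCorank_add_twist_le_of_toricPeriod_ne_zero
    (h : kim_selmerCorank_baseChange_le_of_toricPeriod_ne_zero) :
    ∀ (W : WeierstrassCurve ℚ) [W.IsElliptic] [W.IsGloballyMinimal] (p : ℕ) [Fact p.Prime] (M Nplus
      Nminus n : ℕ) (a b : ℚ) (O : Subring (QuaternionAlgebra ℚ a 0 b)) (K : Type) [Field K]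
      [NumberField K] (ψ : K →ₐ[ℚ] QuaternionAlgebra ℚ a 0 b) (I : Submodule ℤ (QuaternionAlgebra ℚ
      a 0 b)) (φ : Submodule ℤ (QuaternionAlgebra ℚ a 0 b) → ZMod (p ^ M)) (rep : ClassGroup
      (NumberField.RingOfIntegers K) → nonZeroDivisors (Ideal (NumberField.RingOfIntegers K))) (RI :
      Set (Submodule ℤ (QuaternionAlgebra ℚ a 0 b))) (IsEig : (Submodule ℤ (QuaternionAlgebra ℚ a 0
      b) → ZMod (p ^ M)) → Prop), ((5 ≤ p ∧ 1 ≤ M ∧ W.HasGoodReductionAtPrime p ∧ ¬ (p : ℤ) ∣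
      W.frobeniusTrace p ∧ W.HasSurjectiveModNGaloisRep p ∧ (∀ q : ℕ, q.Prime → q ∣ W.conductorNorm
      ℤ → ¬ (p : ℤ) ∣ (q : ℤ) ^ 2 - 1)) ∧ (Module.finrank ℚ K = 2 ∧ NumberField.IsTotallyComplex K ∧
      NumberField.discr K < -4 ∧ Int.gcd (NumberField.discr K) (W.conductorNorm ℤ * p) = 1) ∧
      (W.conductorNorm ℤ = Nplus * Nminus ∧ Nat.Coprime Nplus Nminus ∧ Squarefree Nminus ∧ Odd
      Nminus.primeFactors.card ∧ (∀ q : ℕ, q.Prime → q ∣ Nplus → ((Ideal.span {(q : ℤ)}).primesOver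
      (NumberField.RingOfIntegers K)).ncard = 2) ∧ (∀ q : ℕ, q.Prime → q ∣ Nminus * n → ((Ideal.span
      {(q : ℤ)}).primesOver (NumberField.RingOfIntegers K)).ncard = 1)) ∧ (Squarefree n ∧
      Nat.Coprime n (W.conductorNorm ℤ * p) ∧ Int.gcd (NumberField.discr K) n = 1 ∧ (∀ ℓ : ℕ,
      ℓ.Prime → ℓ ∣ n → ¬ (p : ℤ) ∣ (ℓ : ℤ) ^ 2 - 1 ∧ ((p : ℤ) ^ (2 * M) ∣ W.frobeniusTrace ℓ - (ℓ +
      1) ∨ (p : ℤ) ^ (2 * M) ∣ W.frobeniusTrace ℓ + (ℓ + 1)))) ∧ (a < 0 ∧ b < 0 ∧ (∀ (q : ℕ) [Fact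
      q.Prime], (∀ x : QuaternionAlgebra ℚ_[q] (a : ℚ_[q]) 0 (b : ℚ_[q]), x ≠ 0 → IsUnit x) ↔ q ∣
      Nminus * n)) ∧ (∃ O₁ O₂ : Subring (QuaternionAlgebra ℚ a 0 b), (∀ S : Subring
      (QuaternionAlgebra ℚ a 0 b), (S = O₁ ∨ S = O₂) → (S.toAddSubgroup.FG ∧ (∀ d :
      QuaternionAlgebra ℚ a 0 b, ∃ m : ℤ, m ≠ 0 ∧ m • d ∈ S) ∧ ∀ S' : Subring (QuaternionAlgebra ℚ a
      0 b), S'.toAddSubgroup.FG → S ≤ S' → S' = S)) ∧ O = O₁ ⊓ O₂ ∧ O.toAddSubgroup.relIndex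
      O₁.toAddSubgroup = Nplus) ∧ ((∀ J : Submodule ℤ (QuaternionAlgebra ℚ a 0 b), J ∈ RI ↔ (J.FG ∧
      (∀ d : QuaternionAlgebra ℚ a 0 b, ∃ m : ℤ, m ≠ 0 ∧ m • d ∈ J) ∧ (∀ x : QuaternionAlgebra ℚ a 0
      b, (∀ y ∈ J, y * x ∈ J) ↔ x ∈ O) ∧ (∃ J' : Submodule ℤ (QuaternionAlgebra ℚ a 0 b), (∀ x :
      QuaternionAlgebra ℚ a 0 b, x ∈ J * J' ↔ ∀ y ∈ J, x * y ∈ J) ∧ (∀ x : QuaternionAlgebra ℚ a 0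
      b, x ∈ J' * J ↔ x ∈ O)))) ∧ (∀ g : Submodule ℤ (QuaternionAlgebra ℚ a 0 b) → ZMod (p ^ M),
      IsEig g ↔ ((∀ J ∈ RI, ∀ β : QuaternionAlgebra ℚ a 0 b, IsUnit β → g (J.map
      (AddMonoidHom.mulLeft β).toIntLinearMap) = g J) ∧ (∀ q : ℕ, q.Prime → ¬ q ∣ W.conductorNorm ℤ
      * n → ∀ J ∈ RI, ∑ᶠ J' ∈ {J' : Submodule ℤ (QuaternionAlgebra ℚ a 0 b) | J' ≤ J ∧
      J'.toAddSubgroup.relIndex J.toAddSubgroup = q ^ 2 ∧ ∀ y ∈ J', ∀ x ∈ O, y * x ∈ J'}, g J' =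
      ((W.frobeniusTrace q : ℤ) : ZMod (p ^ M)) * g J))) ∧ IsEig φ ∧ (∃ J ∈ RI, IsUnit (φ J)) ∧ (∀ g
      : Submodule ℤ (QuaternionAlgebra ℚ a 0 b) → ZMod (p ^ M), IsEig g → ∃ u : ZMod (p ^ M), ∀ J ∈
      RI, g J = u * φ J)) ∧ (I ∈ RI ∧ (∀ x : NumberField.RingOfIntegers K, ∀ y ∈ I, ψ (x : K) * y ∈
      I) ∧ (∀ x : K, (∀ y ∈ I, ψ x * y ∈ I) → ∃ z : NumberField.RingOfIntegers K, (z : K) = x) ∧ (∀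
      𝔞 : ClassGroup (NumberField.RingOfIntegers K), ClassGroup.mk0 (rep 𝔞) = 𝔞))) → (∑ 𝔞 :
      ClassGroup (NumberField.RingOfIntegers K), φ (Submodule.span ℤ ((fun x :
      NumberField.RingOfIntegers K => ψ (x : K)) '' ((rep 𝔞 : nonZeroDivisors (Ideal
      (NumberField.RingOfIntegers K))) : Ideal (NumberField.RingOfIntegers K))) * I)) ≠ 0 →
      W.selmerCorank p + (W.quadraticTwist (NumberField.discr K : ℚ)).selmerCorank p ≤
      n.primeFactors.card := by
  intro W _ _ p _ M Nplus Nminus n a b O K _ _ ψ I φ rep RI IsEig hyp hper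
  have hK : Module.finrank ℚ K = 2 := hyp.2.1.1
  have hle := h W p M Nplus Nminus n a b O K ψ I φ rep RI IsEig hyp hper
  rw [selmerCorank_baseChange_quadratic_holds W K hK p] at hle
  exact hle

end Literature.NumberTheory.EllipticCurves
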